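import Literature.MathematicalPhysics.QuantumFieldTheory.Balaban1983to89.B15Prop1FlatAverageBoundOfGuardOn
import Literature.MathematicalPhysics.QuantumFieldTheory.Balaban1983to89.B15Prop1LinearisedKernelLevelZeroB

/-!
# `Balaban1983to89.B15Prop1FlatAverageBoundOfGuardOn` — [Balaban1985Averaging] = «[4]», Sect. D (122)–(126) p. 36, Prop. 4 (134)–(135) pp. 37–39; [Balaban1985BackgroundPropagators] = «[B9]», — **BOND-DATUM EDITION** (`…B15Prop1FlatAverageBoundOfGuardOnB`, USED DECLARATIONS ONLY): the print-datum ([Balaban1984PropagatorsII] (2.3)) twins of the declarations of `B15Prop1FlatAverageBoundOfGuardOn` that N12's junction of record v14ᴸ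
uses with a datum-bearing statement (`exists_flatAverageBound_of_guardOn_towerNearFlat`) — class (γ) of dag-n12-c's census-by-declaration v2 (bus [DAGN12C-G35], 2026-08-30).  GENERATOR (block-extracted from the
parent's tree bytes by HOME `lean/g35/gen/gen_blocks.py`): namespace `…B`, SAME names, `DetSet ↦ BDetSet` (F0a), `AgreeOn ↦ AgreeOnB`, `IsMinimizer ↦ IsMinimizerB`, `bondsOf (𝐁 j) ↦ 𝔅 j`, `constrCard ∕
constrEnum ∕ ConstrSet ∕ msChart ↦ …B` (lane `Node00/MultiScaleFibreChartB`), `IsCritOnFibre ∕ IsFibreChartNear ↦ …B`; proofs VERBATIM; the parent's other (datum-free) declarations REUSED by `open`.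

statement-level skeleton of published theorems with citation tags; proofs where landed; nothing here is a claim about
the Yang–Mills mass gap

Cell `pub-ymgap` (HUMAN RULINGS D-0062 ∕ D-0149), lane `pub-ymgap-dag-n12-c` g35 (R134 seat (a), N12 = [B15], s1, lane owner); `--kind proof --supports` K1⁹ `stmt-QuantumFields-27364`; count-neutral.
THEOREMS ONLY (0 `def`, 0 `instance`, 0 `sorry`).  HONESTY GUARD (director-ym №338 (5)): PURELY ADDITIVE — the parent stays landed and true on its own text; nothing in it is edited; no displayed
premise of any consumer is deleted or weakened; every hypothesis stays a hypothesis.  Nothing of Bałaban's analysis asserted; N12 NOT discharged; K0⁷ ∕ K1⁹ NOT closed; one finite 𝕋⁴ programme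
at fixed ε — nothing continuum ∕ ℝ⁴ ∕ OS; the Yang–Mills mass gap (Clay) is NOT proved by any of this.

PARENT's DOCSTRING (mathematics and citations; read `𝐁` as the bond datum `𝔅`):
# `Balaban1983to89.B15Prop1FlatAverageBoundOfGuardOn` — [Balaban1985Averaging] = «[4]», Sect. D (122)–(126) p. 36, Prop. 4 (134)–(135) pp. 37–39; [Balaban1985BackgroundPropagators] = «[B9]»,
# p. 406 (3.79)–(3.81); [Balaban1985Variational] = «[15]», (44)–(48) p. 285, (82)–(83) p. 290; [Balaban1988Convergent] (2.2) p. 255, (2.10)–(2.13) pp. 256–257: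
# THE (L) LETTER OF `B15Prop1FlatCoerciveSplit` INHABITED (qualitative constants) AT EVERY TOWER-GUARDED BASE FIELD NEAR-FLAT ON ITS POSITIVE-LEVEL TOWERS —
# `Σ_i ‖(Q_{j_i}(1)p̂)(c_i)‖² ≤ (#constr·C²·δ²)·Σ_b‖p_b‖²` for every real slice field `p` in the kernel of the linearised constraint

Honest framing: statement-level skeleton of published theorems with citation tags; proofs where landed; nothing here is a claim about the
Yang–Mills mass gap.  Cell `pub-ymgap`, HUMAN RULING D-0062 (Track A), seat `pub-ymgap-dag-n12-c` g25 (lane owner N12 = [B15], strategy s1); count-neutral; N12 NOT discharged;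
finite 𝕋⁴ at fixed ε; nothing continuum ∕ OS ∕ mass-gap ∕ Clay.

WHY (lane memo `N12-UNIFORMITY-SPEC.md` §8).  `B15Prop1FlatCoerciveSplit` reduces the (β)-split's flat coercivity letter (P) to (P♭Q) (a theorem per instance: the lane's
`…N12FlatAveragedCoerciveOfForest[SU2Chart]`) and (L): `Σ_i ‖(Q_{j_i}(1)p̂)(c_i)‖² ≤ CL·Σ_b‖p_b‖²` for real slice fields `p` with `DΦ₀(0)⟨cplxVec p⟩ = 0`.  THIS FILE inhabits (L) at every
base configuration `U₀` carrying the (J0′) producer's own rows — the per-tower (0.4) guards (read off the class at the record, `…N12TowerGuardsOfClass`) and `AgreeOn 𝔹 (M˙U₀) W` — plus ONE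
near-flatness row: `‖↑U₀(b) − 1‖ ≤ δ` on the level-`0` bonds of the tower regions of the POSITIVE-LEVEL constrained bonds (a GAUGE row, the species of the direct road's (N) clause; nothing on
`Γ₀`, where `U₀` is the rough datum).  Per constrained bond: level `0` ⇒ the term vanishes (`B15Prop1LinearisedKernelLevelZero` §3: the field itself vanishes there); level `≥ 1` ⇒ kernel ⇒
zero velocities (ibid. §2) ⇒ `B15Prop1FlatAverageBoundOfTowerNearFlat` (the tower splice + the C²-calculus on the tower-holomorphic iterate) ⇒ `‖(Q_{j_i}(1)p̂)(c_i)‖ ≤ C_i·δ·‖p̂‖`; and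
`‖p̂‖²_sup ≤ Σ_b‖p_b‖²` (`‖p̂_b‖_op = ‖p_b‖`, dag-n12-w2's `norm_coe_lieSU2Coord`).  Constants `C := Σ_i C_i`, `r := min_i r_i` — EXISTENTIAL, depending on `(P, k, 𝔹)` only
(uniform over base fields and data); print's quantitative `O(L²α₀)` ([4] Prop. 3) is not claimed.

CONTENTS (theorems only; no `def`, no `instance`, no `sorry`).  ★★★ `exists_flatAverageBound_of_guardOn_towerNearFlat`.
HONEST SCOPE: bookkeeping over landed lemmas; constants existential; nothing of Bałaban's estimates asserted; count-neutral; N12 NOT discharged; the YM mass gap (Clay) is NOT proved by any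
of this — R4 closes only the conditional finite-𝕋⁴ rung `BalabanLadder.UV`.
-/


noncomputable section

namespace Literature.MathematicalPhysics.QuantumFieldTheory.Balaban1983to89.B15Prop1FlatAverageBoundOfGuardOnB

open B15Prop1FlatAverageBoundOfGuardOn


open Set Metric Filter
open scoped Topology BigOperators
open Literature.MathematicalPhysics.QuantumFieldTheory.Balaban1983to89.Node00 (SU coeField coeField_apply SmallBelow ConstrSetB constrCardB constrEnumB dIterL dIterL_zero)
open T4AdjointCovarianceUnitary (lieSU)
open B10Eq42TorusConstraint (bondsIn)
open B14.Eq22Determines (blockIter)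
open B15AveragingHolomorphic (iterMh)
open B15SU2ChartHolomorphic (genE expMulC logCoordC quatMatrix_imQuat)
open B16Ineq19FlatSliceChart (exists_lieSU2Coord)
open B16Ineq19NearFlatSlice (norm_coe_lieSU2Coord)
open B15Prop1LinearisedKernelLevelZeroB (velocity_eq_zero_of_fderiv_sliceDatum_eq_zero_of_guardOn_constr apply_eq_zero_of_fderiv_sliceDatum_eq_zero_of_mem_bondsOf_zero_of_guardOn)
open B15Prop1FlatAverageBoundOfTowerNearFlat (exists_norm_dIterL_one_apply_le_of_velocity_zero_towerNearFlat)
open B15Prop1AnalyticExtClause (cplxVec)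
open B15Prop1ChartCalculusSU2 (E3)
open B15Prop1ChartSU2 (su2Chart)
open B16Sect1Backgrounds (expMul)
open ExpMeanLog (expMeanLogSU)
open BlockAveraging (blockAvg)
open T4CubeChartGnomonic (SU2)
open T4Continuum B15DeterminingSets B15DeterminingSetsB GaugeField
open scoped Matrix.Norms.L2Operator

variable {P : Params}



section

/-- ★★★ **THE (L) LETTER INHABITED AT A TOWER-GUARDED, TOWER-NEAR-FLAT BASE FIELD (qualitative constants).**  For a determining set `𝔅` read below `k ≤ m + K` there are a constant
`C ≥ 0` and a radius `r > 0` (depending on `(P, k, 𝔅)` only) such that: for every multi-scale datum `W`, every `SU(2)` field `U₀` on its fibre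
(`AgreeOn`) with the ENUMERATED PER-TOWER GUARDS of the (J0′) producers, every slice `S` with slice datum coordinates `Φ₀` (pointwise, as in every producer), every `0 ≤ δ ≤ r` such that `‖↑U₀(b) − 1‖ ≤ δ` on the level-`0` bonds of the tower region `B^{j_i}⁻¹{c_{i,−}, c_{i,+}}` of every POSITIVE-LEVEL constrained bond — the (L) letter of
`B15Prop1FlatCoerciveSplit` holds with `CL := #constr·C²·δ²`: for every real slice field `p` with `DΦ₀(0)⟨cplxVec p⟩ = 0`,
`Σ_i ‖(dIterL j_i ↑1 p̂)(c_i)‖² ≤ (#constr·C²·δ²)·Σ_b‖p_b‖²`.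
[cite: Balaban1985Averaging, (122)–(126) p.36, Prop. 4 (134)–(135) pp.37–39; Balaban1985BackgroundPropagators, (3.79)–(3.81) p.406; Balaban1985Variational, (44)–(48) p.285, (82)–(83) p.290; Balaban1988Convergent, (2.2) p.255, (2.10)–(2.13) pp.256–257] -/
theorem exists_flatAverageBound_of_guardOn_towerNearFlat (𝔅 : BDetSet P) (k : ℕ) (hk : k ≤ P.m + P.K) :
    ∃ C r : ℝ, 0 ≤ C ∧ 0 < r ∧
      ∀ (W : MSField P SU2) (U₀ : GaugeField P 0 SU2),
        (∀ i : Fin (constrCardB 𝔅 k), ∀ j', j' < (((constrEnumB 𝔅 k).symm i).1 : ℕ) → ∀ c' : PBond P (j' + 1),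
          c' ∈ bondsIn (j' + 1) (blockIter (((constrEnumB 𝔅 k).symm i).1 : ℕ) ⁻¹'
            ({((constrEnumB 𝔅 k).symm i).2.1.src, ((constrEnumB 𝔅 k).symm i).2.1.tgt} : Set (Site P ((constrEnumB 𝔅 k).symm i).1))) →
            BlockAveraging.Small expMeanLogSU (Averaging.iter (fun j => blockAvg (P := P) (j := j) expMeanLogSU) j' U₀) c') →
        AgreeOnB 𝔅 (avgFamily (fun j => blockAvg (P := P) (j := j) expMeanLogSU) U₀) W →
        ∀ (S : Submodule ℂ (VecField P 0 (EuclideanSpace ℂ (Fin 3)))) (Φ₀ : S → Fin (constrCardB 𝔅 k) → EuclideanSpace ℂ (Fin 3)),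
          (∀ (X : S) i, Φ₀ X i = logCoordC (star ((W ((constrEnumB 𝔅 k).symm i).1 ((constrEnumB 𝔅 k).symm i).2.1 : SU2) : Matrix (Fin 2) (Fin 2) ℂ) *
            iterMh ((constrEnumB 𝔅 k).symm i).1 (expMulC (X : VecField P 0 (EuclideanSpace ℂ (Fin 3))) (coeField U₀)) ((constrEnumB 𝔅 k).symm i).2.1)) →
          ∀ {δ : ℝ}, 0 ≤ δ → δ ≤ r →
            (∀ i : Fin (constrCardB 𝔅 k), 0 < (((constrEnumB 𝔅 k).symm i).1 : ℕ) →
              ∀ b : PBond P 0, b ∈ bondsIn 0 (blockIter (((constrEnumB 𝔅 k).symm i).1 : ℕ) ⁻¹'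
                ({((constrEnumB 𝔅 k).symm i).2.1.src, ((constrEnumB 𝔅 k).symm i).2.1.tgt} : Set (Site P ((constrEnumB 𝔅 k).symm i).1))) →
                ‖((U₀ b : SU2) : Matrix (Fin 2) (Fin 2) ℂ) - 1‖ ≤ δ) →
            ∀ (p : VecField P 0 E3) (hp : cplxVec p ∈ S), fderiv ℂ Φ₀ 0 ⟨cplxVec p, hp⟩ = 0 →
              ∑ i : Fin (constrCardB 𝔅 k), ‖dIterL ((constrEnumB 𝔅 k).symm i).1 (coeField (1 : GaugeField P 0 SU2))
                  (fun b => ∑ a : Fin 3, ((p b a : ℝ) : ℂ) • genE a) ((constrEnumB 𝔅 k).symm i).2.1‖ ^ 2 ≤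
                ((constrCardB 𝔅 k : ℝ) * C ^ 2 * δ ^ 2) * ∑ b : PBond P 0, ‖p b‖ ^ 2 := by
  -- per constrained bond: the calculus constants of `B15Prop1FlatAverageBoundOfTowerNearFlat`
  have hlev : ∀ i : Fin (constrCardB 𝔅 k), (((constrEnumB 𝔅 k).symm i).1 : ℕ) ≤ P.m + P.K :=
    fun i => (Nat.lt_succ_iff.1 ((constrEnumB 𝔅 k).symm i).1.2).trans hk
  choose C r hC hr hH using fun i : Fin (constrCardB 𝔅 k) =>
    exists_norm_dIterL_one_apply_le_of_velocity_zero_towerNearFlat (P := P) (((constrEnumB 𝔅 k).symm i).1 : ℕ) (hlev i) ((constrEnumB 𝔅 k).symm i).2.1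
  -- one radius below all the per-bond radii (finitely many)
  obtain ⟨r₀, hr₀, hr₀le⟩ : ∃ r₀ : ℝ, 0 < r₀ ∧ ∀ i, r₀ ≤ r i := by
    by_cases hne : (Finset.univ : Finset (Fin (constrCardB 𝔅 k))).Nonempty
    · exact ⟨Finset.univ.inf' hne r, (Finset.lt_inf'_iff hne).2 fun i _ => hr i, fun i => Finset.inf'_le r (Finset.mem_univ i)⟩
    · refine ⟨1, one_pos, fun i => ?_⟩
      exact absurd ⟨i, Finset.mem_univ i⟩ hne
  refine ⟨∑ i, C i, r₀, Finset.sum_nonneg fun i _ => hC i, hr₀, fun W U₀ hgU hU₀ S Φ₀ hΦ₀ δ hδ0 hδr hflat p hp hker => ?_⟩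
  set phat : PBond P 0 → Matrix (Fin 2) (Fin 2) ℂ := fun b => ∑ a : Fin 3, ((p b a : ℝ) : ℂ) • genE a with hphat
  have hCle : ∀ i, C i ≤ ∑ i, C i := fun i => Finset.single_le_sum (f := C) (fun i _ => hC i) (Finset.mem_univ i)
  have hCsum : 0 ≤ ∑ i, C i := Finset.sum_nonneg fun i _ => hC i
  -- the per-bond bound `‖(dIterL j_i ↑1 p̂)(c_i)‖ ≤ (Σ C)·δ·‖p̂‖`
  have hterm : ∀ i : Fin (constrCardB 𝔅 k),
      ‖dIterL ((constrEnumB 𝔅 k).symm i).1 (coeField (1 : GaugeField P 0 SU2)) phat ((constrEnumB 𝔅 k).symm i).2.1‖ ≤ (∑ i, C i) * δ * ‖phat‖ := by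
    intro i
    by_cases h0 : (((constrEnumB 𝔅 k).symm i).1 : ℕ) = 0
    · -- level `0`: the field itself vanishes at the constrained bond
      have hzero : dIterL ((constrEnumB 𝔅 k).symm i).1 (coeField (1 : GaugeField P 0 SU2)) phat ((constrEnumB 𝔅 k).symm i).2.1 = 0 := by
        generalize hx : (constrEnumB 𝔅 k).symm i = x at h0 ⊢
        obtain ⟨⟨j, hjk⟩, c, hc⟩ := x
        simp only at h0
        subst h0
        -- `Q₀ = id`: the flat "average" is the field, and `p̂_c·U₀(c) = 0` by the zero velocity at the level-`0` constraint
        have hsb0 : SmallBelow (fun j => blockAvg (P := P) (j := j) expMeanLogSU) 0 U₀ := fun j hj => absurd hj (Nat.not_lt_zero j)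
        have hv0 := B15Prop1RightInverseFromLinearisedAveraging.hasDerivAt_coe_avgFamily_expMul_smul (j := 0) hsb0 p c
        rw [dIterL_zero, ContinuousLinearMap.id_apply] at hv0
        have hpc : phat c * ((U₀ c : SU2) : Matrix (Fin 2) (Fin 2) ℂ) = 0 :=
          velocity_eq_zero_of_fderiv_sliceDatum_eq_zero_of_guardOn_constr 𝔅 k hk W hgU hU₀ S hΦ₀ hp hker ⟨⟨0, hjk⟩, c, hc⟩ hv0
        have hphatc : phat c = 0 := by
          calc phat c = (phat c * ((U₀ c : SU2) : Matrix (Fin 2) (Fin 2) ℂ)) * star ((U₀ c : SU2) : Matrix (Fin 2) (Fin 2) ℂ) := by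
                rw [mul_assoc, Unitary.mul_star_self_of_mem (Matrix.specialUnitaryGroup_le_unitaryGroup (U₀ c).2), mul_one]
            _ = 0 := by rw [hpc, zero_mul]
        show dIterL 0 (coeField (1 : GaugeField P 0 SU2)) phat c = 0
        rw [dIterL_zero, ContinuousLinearMap.id_apply, hphatc]
      rw [hzero, norm_zero]
      positivity
    · -- positive level: the tower calculus
      have hpos : 0 < (((constrEnumB 𝔅 k).symm i).1 : ℕ) := Nat.pos_of_ne_zero h0
      have hvel : ∀ v : Matrix (Fin 2) (Fin 2) ℂ,
          HasDerivAt (fun s : ℝ => ((avgFamily (fun j => blockAvg (P := P) (j := j) expMeanLogSU) (expMul su2Chart (s • p) U₀) ((constrEnumB 𝔅 k).symm i).1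
            ((constrEnumB 𝔅 k).symm i).2.1 : SU2) : Matrix (Fin 2) (Fin 2) ℂ)) v 0 → v = 0 :=
        fun v hv => velocity_eq_zero_of_fderiv_sliceDatum_eq_zero_of_guardOn_constr 𝔅 k hk W hgU hU₀ S hΦ₀ hp hker ((constrEnumB 𝔅 k).symm i) hv
      have h := hH i U₀ (hgU i) hδ0 (hδr.trans (hr₀le i)) (hflat i hpos) p hvel
      exact h.trans (mul_le_mul_of_nonneg_right (mul_le_mul_of_nonneg_right (hCle i) hδ0) (norm_nonneg _))
  -- sum the squares and compare `‖p̂‖²` with `Σ_b ‖p_b‖²`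
  have hsq : ∀ i : Fin (constrCardB 𝔅 k),
      ‖dIterL ((constrEnumB 𝔅 k).symm i).1 (coeField (1 : GaugeField P 0 SU2)) phat ((constrEnumB 𝔅 k).symm i).2.1‖ ^ 2 ≤ ((∑ i, C i) * δ * ‖phat‖) ^ 2 :=
    fun i => pow_le_pow_left₀ (norm_nonneg _) (hterm i) 2
  have hmass := norm_sq_matField_le_sum p
  calc ∑ i : Fin (constrCardB 𝔅 k), ‖dIterL ((constrEnumB 𝔅 k).symm i).1 (coeField (1 : GaugeField P 0 SU2)) phat ((constrEnumB 𝔅 k).symm i).2.1‖ ^ 2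
      ≤ ∑ _i : Fin (constrCardB 𝔅 k), ((∑ i, C i) * δ * ‖phat‖) ^ 2 := Finset.sum_le_sum fun i _ => hsq i
    _ = (constrCardB 𝔅 k : ℝ) * (((∑ i, C i) * δ) ^ 2 * ‖phat‖ ^ 2) := by
        rw [Finset.sum_const, Finset.card_univ, Fintype.card_fin, nsmul_eq_mul]
        ring
    _ ≤ (constrCardB 𝔅 k : ℝ) * (((∑ i, C i) * δ) ^ 2 * ∑ b : PBond P 0, ‖p b‖ ^ 2) := by
        apply mul_le_mul_of_nonneg_left _ (by positivity)
        exact mul_le_mul_of_nonneg_left hmass (by positivity)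
    _ = ((constrCardB 𝔅 k : ℝ) * (∑ i, C i) ^ 2 * δ ^ 2) * ∑ b : PBond P 0, ‖p b‖ ^ 2 := by ring

end

end Literature.MathematicalPhysics.QuantumFieldTheory.Balaban1983to89.B15Prop1FlatAverageBoundOfGuardOnB

end
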